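import Summits.AtomisticToContinuum.Crystallization.Theses.ChessboardParticlePlanes
import Summits.AtomisticToContinuum.Crystallization.Theorems.ReggeStarCoercivityDefectFreeCrystallizesSqueezeToLayeredA
import Summits.AtomisticToContinuum.Crystallization.Theorems.ChessboardParticlePlanesLjLaminarWindowsOneWindowAllScales
import Summits.AtomisticToContinuum.Crystallization.Theorems.ChessboardParticlePlanesLjLaminarWindowsPinnedGluing
import Summits.AtomisticToContinuum.Crystallization.Theorems.ChessboardParticlePlanesLjLaminarWindowsPinnedSqueeze
import Summits.AtomisticToContinuum.Crystallization.Theorems.ChessboardParticlePlanesLjLaminarWindowsLawWindows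
import Summits.AtomisticToContinuum.Crystallization.Theorems.ChessboardParticlePlanesLjLaminarWindowsPinningChargeDoors
import Summits.AtomisticToContinuum.Crystallization.Theorems.ChessboardParticlePlanesLjLaminarWindowsBlockDoor
-- rev 2 (lead a1, 2026-08-17): the import incident of rev 1 (route file rev 4 ↔ `MuGSC` duplicate `UniformlyDiscrete`) was
-- repaired at the root by p159647 (`…LjLaminarWindowsGlueLevels` now imports `Literature…TwoScaleShellSums`), so the tree
-- theorem `LjLaminarWindowsSketch.LjLaminarWindows_of_oneWindowAllScales` (p137588) is importable again and closes
-- `stub_cruxOfOneWindowAllScales`; `stub_pinnedGluing` is the tree theorem `StackingBlindBudgetFlatness.stub_pinnedGluing`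
-- (p159322, parts p158862); the def-free glue (generic squeeze, clean centres, laminar reading) is p157869 (`…PinnedSqueeze`).
-- rev 4 (lead c16, 2026-08-17T14:10Z): `FunnelLawRigidity ⇐ CORE` is LANDED by the 13603 lead as
-- `Summit.AtomisticToContinuum.Crystallization.Theorems.PalmGoodLaw.ExactStarShortcut.funnelLawRigidity_of_core` (p162359), but that
-- module imports `Literature…MuGSC` while THIS file (through the route file `Theses.ChessboardParticlePlanes`) imports
-- `Literature…MuGroundStateConfiguration`; the two Literature modules declare the same 7 fully-qualified names, so the import
-- `import Summits.AtomisticToContinuum.Crystallization.Theorems.ReggeStarCoercivityDefectFreeCrystallizesExactStarShortcut`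
-- CANNOT be added here ("environment already contains '…UniformlyDiscrete'", lean check of `work/tests/ConeConflict.lean`).
-- Hence `stub_funnelLawRigidity` stays a sorry although it is a theorem modulo 13603's CORE: it becomes the one line
-- `funnelLawRigidity_of_core stub_funnelDefectFloor` the moment the Literature restructure (prepared, attached as evidence
-- `MuGroundStateConfiguration.restructured.lean` / `IMPORT-SPLIT.md` on the crux item) lands.  Stub list unchanged.
-- rev 5 (lead c16, 15:15Z): ALT B's whole in-file glue (cover lemma, generic squeeze, clean pinned centres, pinned windows, laminar
-- reading, `oneWindowAllScales_of_stubs`) is LANDED as ONE door `Theorems.StackingBlindBudgetFlatness.stub_blockWindows` /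
-- `LjLaminarWindows_of_blockCoercivity` (p165360, `…LjLaminarWindowsBlockDoor.lean`) and deleted here (916 → 456 lines); registered stubs:
-- stub_zeroDefectDensity, stub_splitCoercivity, stub_pinningCharge, stub_funnelLawRigidity, stub_palmRigidity.

/-!
# Line `stacking-blind-budget-flatness` — crux `ChessboardParticlePlanes.LjLaminarWindows`
# (stmt-AtomisticToContinuum-6711), route ChessboardParticlePlanes; crux-plan skeleton (planner, 2026-08-17)

Idea card: `Cruxes/LjLaminarWindows/Ideas/stacking-blind-budget-flatness.md` (ideator 1, triage r1: pass/pass).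
Line card: `Cruxes/LjLaminarWindows/Lines/stacking-blind-budget-flatness.md`.

## The line in one paragraph

The `o(N)` energy budget of a Lennard-Jones ground-state sequence (`E(x N) − N e* = o(N)`, tree:
`PrestressSplitKorn.squeeze_tendsto_sum_excess_div`) is spent against a WORD-UNIFORM, LETTER-FREE coercivity of
the Barlow family: (S1) a fixed-tolerance first-shell input makes the defective fraction vanish; (S2a) layered
coercivity with slack charges the non-`η`-layered good sites; (S2b) a PINNING CHARGE — new and specific to this
crux — charges good sites that are `η`-layered in the cone's box (interlayer increments `≥ 39a/50 ≥ 0.7332`) but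
not in the PINNED box (increments `≥ 19/25 = 0.76`): the crux's constant `3/4` is an ENERGETIC constant (a
flattened hcp block with `h = 0.74`, `a = 0.94` is crux-good, box-layered and has NO family of parallel planes
`≥ 3/4` apart, so "scale is pinned by energy", card point (2), is exactly the load `6711` adds to the cone);
the generic squeeze (`gsqueeze_tendsto_card_div`, verbatim the tree's squeeze with an arbitrary predicate) and
packing (`eventually_exists_pinned_centre`) give clean pinned centres of every radius for all large `N`; (S3)
PINNED GLUING (centred, pinned port of the PROVED `PrestressSplitKorn.stub_layeredGluing`) turns them into one
rigid pinned window of radius `R` and tolerance `ε`; `laminar_of_pinnedNear` reads such a window through the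
inverse rotation as an `ε`-laminar closed `R`-window with planes `≥ 3/4` apart (`sep_of_increments`:
`19/25 > 3/4`), i.e. S9♭ at `(L, η) = (R, ε)` for EVERY `L` and eventually in `N`; the tree equivalence
`LjLaminarWindowsSketch.LjLaminarWindows_iff_oneWindowAllScales` (p137588) supplies the crux's energy clause and
`7/10`-separation for free (carried as `stub_cruxOfOneWindowAllScales` while un-importable, header comment).
Composition: `LjLaminarWindows_of` (sorry-free; sorries only in the stubs).

## Status rev 3 (lead a1, 2026-08-17T15:30Z) — THREE compositions, the crux BY NAME from each (first = primary)

PRIMARY (law-level form of the line = card reshape option (3); tree theorem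
`Theorems.StackingBlindBudgetFlatness.LjLaminarWindows_of_funnelLawRigidity`, p161919): `LjLaminarWindows_of` from the TWO stubs
`stub_zeroDefectDensity` (S1 = item 13604, unchanged) and `stub_funnelLawRigidity` (FLR: VERBATIM the second hypothesis of the landed
`PalmGoodLaw.ChargeFromFunnelLaw.stub_chargeFromFunnelLaw`; it is the sorry-free consequence `funnelLawRigidity_of_stubs` of crux 13603's
ONE remaining registered stub, the CORE `stub_funnelDefectFloor`, over that crux's landed X2a/X2b/X2c/X3 — so it closes when 13603's CORE
closes).  Mechanism unchanged, read at law level: the budget is the minimality `E_P[h] ≤ e*` of the good Benjamini–Schramm limit law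
(`stub_goodLaw`, landed), the coercivity is the programme's CORE, the PINNED SCALE comes for free from optimality ("pinning is free"
`hcpE_globalMin_of_energy_eq_eStar` + `tube_hcpE_unique_minimiser` + `tube_minimiserEnclosure`: a.s. the law is the rotated EXACT
`hcpStacking a₀ h₀`, `h₀ ≥ 0.7928 > 3/4`), and the density-transfer clause of the limit law replaces squeeze + packing + gluing
(`frequently_laminarWindow_of_hcpLaw`): laminar windows of every radius frequently in `N` = S9♭ ⇒ crux (p137588).
ALTERNATIVE A (one stub): `LjLaminarWindows_of_palm` from `stub_palmRigidity` = route PalmUnimodularRigidity's target `PalmRigidity`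
BY NAME (⇐ cruxes 9225 `MinimiserShells` ∧ 9226 `LayeredLawsSelectHcp`, glue landed), for ALL sequences via the PROVED Benjamini–Schramm
limit (tree theorem `LjLaminarWindows_of_palmRigidity`, p161919).
ALTERNATIVE B (block level, the planner's original composition): `LjLaminarWindows_of_blocks` from `stub_zeroDefectDensity`,
`stub_splitCoercivity` (S2a, XL, orphaned by 13603's reshape) and `stub_pinningCharge` (S2b, XL); its doors are landed
(`…PinningChargeDoors`, p161203: tail localisation = the `c = 0` case is a theorem; internal-energy door), S3 `stub_pinnedGluing`
(p159322) and S5 (p137588 after the import repair p159647) are CLOSED, glue p157869.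
Registered stubs after rev 3: stub_zeroDefectDensity, stub_funnelLawRigidity, stub_palmRigidity, stub_splitCoercivity, stub_pinningCharge.

## Status rev 4 (lead c16, 2026-08-17T14:10Z) — stub list UNCHANGED; what moved is outside this file

* `stub_funnelLawRigidity` is now a theorem MODULO 13603's CORE in the tree: `PalmGoodLaw.ExactStarShortcut.funnelLawRigidity_of_core :
  CORE → FunnelLawRigidity` (p162359, 13603 lead c9; X2/X3 discharged).  Mathematically the PRIMARY composition is therefore
  crux ⇐ {item 13604 `ZeroDefectDensity`, 13603's registered CORE `stub_funnelDefectFloor`} — both shared inputs of the hcp programme,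
  nothing 6711-specific open.
* FORMALLY the composition `LjLaminarWindows_of_funnelLawRigidity stub_zeroDefectDensity (funnelLawRigidity_of_core CORE)` cannot be
  written in any Lean file today: `Literature…MuGSC` (imported by 13603's tower) and `Literature…MuGroundStateConfiguration` (imported
  by the route file `Theses.ChessboardParticlePlanes`, for `BallMatch`) declare the same 7 names (`UniformlyDiscrete`, `UniformlyDiscrete.mono`,
  `uniformlyDiscrete_empty`, `IsMuGSC`, `IsMuGSC.summable`, `IsMuGSC.le`, `isMuGSC_empty_iff`); import cones 174 / 468 modules, intersection 0.
  Root fix prepared by this lead (one Literature file: `MuGroundStateConfiguration.lean` imports `MuGSC.lean` and drops its copies; lean check rc 0;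
  gate dry-run bounces only on the textual `lint.removes-referenced-decl`, so it needs an operator/librarian restructure) — evidence
  `IMPORT-SPLIT.md`, `MuGroundStateConfiguration.restructured.lean` on stmt-6711.  The same split would break 58 (resp. 146) landed cone-B
  Theorems files importing `Theses.ReggeStarCoercivity` (resp. `Theses.PalmUnimodularRigidity`) the moment a cone-A `_holds` link is appended there.
* ALT A is behind the same wall (the 9225/9226 towers import `MuGSC`); ALT B (block level) is cone-neutral but XL and dominated.

## Status rev 5 (lead c16, 2026-08-17T15:15Z) — ALT B is ONE landed door; 916 → 456 lines

* LANDED p165360 `Theorems/ChessboardParticlePlanesLjLaminarWindowsBlockDoor.lean` (`--supports 6711`): `stub_blockWindows : ZeroDefectDensity →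
  SplitCoercivity → (pinning charge, raw form of stub_pinningCharge) → S9♭` (= `oneWindowAllScales_of_blockCoercivity`) and, by name,
  `LjLaminarWindows_of_blockCoercivity : … → LjLaminarWindows` (through p137588); new content = the cover lemma `coercivity_of_cover` + the assembly
  over the landed glue p157869 / p159322.  The in-file Glue 1–5 and `oneWindowAllScales_of_stubs` of rev 1–4 are deleted; `LjLaminarWindows_of_blockDoor`
  composes the door with the three block stubs.  Inputs of the door are cone-neutral finite-configuration statements (insensitive to the import split).
* Registered stubs (5): stub_zeroDefectDensity (= 13604), stub_funnelLawRigidity (transport of p162359, needs the restructure), stub_palmRigidity (⇐ 9225 ∧ 9226),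
  stub_splitCoercivity (S2a, XL, orphaned), stub_pinningCharge (S2b, XL).  Three compositions conclude the crux by name: `LjLaminarWindows_of` (PRIMARY),
  `LjLaminarWindows_of_palm` (ALT A), `LjLaminarWindows_of_blockDoor` (ALT B).

## Registered stubs (4 genuine + 1 tree theorem carried as a stub during the import incident, see the header comment)

* `stub_zeroDefectDensity`  — S1, INPUT, by name = item stmt-13604 `ReggeStarCoercivity.ZeroDefectDensity` (open-problem grade;
  ⇐ 13600 `StarCoercivity` by the proved 13605, or ⇐ 13956 `CoerciveTwoShellGap` by `HullBridgeExact.stub_badFraction`).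
* `stub_splitCoercivity`    — S2a, by name = `PrestressSplitKorn.SplitCoercivity` (registered stub S4 of crux 13603, survived its
  drefute): the card's `BarlowBlockCoercivity` after Chebyshev + discrete Korn, word-uniform and letter-free. XL.
* `stub_pinningCharge`      — S2b, NEW (`PinningCharge`): flattened bilayers are charged at `c(δ, η) > 0` with slack (numerics
  calc/pinning.py: one gap flattened to `0.76` costs `6.6e-3` per site of the two layers at `a = 0.9713`, `1.3e-2` at `a = 0.94`,
  `2.6e-3` at `a = 1`, identical for fcc/hcp/dhcp to `1e-4`; `h_eq(a) ∈ [0.782, 0.804] > 0.76` on the whole box). L–XL, HARDEST NEW.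
* `stub_pinnedGluing`       — S3, NEW (`PinnedGluing`): potential-free; exact pinned rigidity (= `exactLayeredRigidity_holds` +
  uniqueness of the stacking normal off locally-ideal cubic balls, where all four normals are pinned since `a√(2/3) ≥ 0.767`)
  + the compactness argument of `layeredGluing_of_exactRigidity` (the recentred limit set contains `0`: centred window). L.
* `stub_cruxOfOneWindowAllScales` — S9♭ ⇒ crux: IS the tree theorem `LjLaminarWindowsSketch.LjLaminarWindows_of_oneWindowAllScales`
  (p137588, Theorems/ChessboardParticlePlanesLjLaminarWindowsOneWindowAllScales.lean), provable by `exact` the moment that module is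
  co-importable with the route file again (MuGSC / MuGroundStateConfiguration duplicate, header comment). Size: 1 line. Not work.

Disproof used: none exists for this crux (payload `disproof_path` absent on disk, `ledger crux ls` lists no Disproof.lean,
both triagers confirm); negatives index checked (`ledger negatives`: 3506 needs the missing separation — `PinnedGluing` is
`δ`-separated like the proved `LayeredGluing`; 17253 one-multiplier linear pricing — `PinningCharge` has free charts per site,
no fixed reference `(a₀, h₀)`; 15929 / 4146 concern shell censuses and local Hales, not used).
Dead lines honoured: `Sketch` / `IdeatorOneSketch` (residual crux-equivalent S9♯): here the residual is split into four
statements none of which mentions ground states except S1 (an existing item) — S2a/S2b are finite-configuration inequalities,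
S3 is potential-free geometry; triage r1-2's typed objections (`RigidOptimalBarlowWindows` false at small `R`, `WindowsGlue`
vacuous, `BarlowBlockCoercivity` untyped, local Hales step non-quantitative) are all met: no energy clause in the window format,
coercivity typed (`SlackCoercive`), and `laminar_of_pinnedNear` is the quantitative local step (`ε ≤ η`, any `R`).
-/

noncomputable section

open scoped BigOperators Classical
open Filter Topology

namespace Summit.AtomisticToContinuum.Crystallization.Cruxes.LjLaminarWindows.StackingBlindBudgetFlatness

open Literature.MathematicalPhysics.StatisticalMechanics Literature.Geometry.DiscreteGeometry
open Summit.AtomisticToContinuum.Crystallization.Theorems (ChargedEnergyGapNegative.eStar)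
open Summit.AtomisticToContinuum.Crystallization.Theses.ReggeStarCoercivity (ZeroDefectDensity)
open Summit.AtomisticToContinuum.Crystallization.Theorems.PrestressSplitKorn
open Summit.AtomisticToContinuum.Crystallization.Theorems.DefectFreeCrystallizes.Negative.PredicateAPI
  (Good defects)

local notation "E3" => EuclideanSpace ℝ (Fin 3)

/-! ## Vocabulary -/

/-- The PINNED relaxation box: the cone's box `InBox` (in-layer spacing `a ∈ [47/50, 1]`, every interlayer
increment in `[39a/50, 17a/20]`) AND every increment `≥ 19/25 = 0.76 > 3/4`. (All relaxed Barlow words have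
`h_w ≈ 0.793 ∈ [max (19/25) (39a_w/50), 17a_w/20]`; `19/25` is the constant of route LaminarSixThreeThree, margin `0.033`.) -/
def InBoxPinned (a : ℝ) (z : ℤ → ℝ) : Prop :=
  InBox a z ∧ ∀ m : ℤ, 19 / 25 ≤ z (m + 1) - z m

/-- **Pinned layered window of radius `r` and tolerance `η` at particle `i`**: after a translation `t`,
the closed `r`-ball of particle `i` is two-way `η`-matched with a rigid image `A ∘ layeredPos a s z` of a
PINNED box template (any Hägg word `s`, free heights `z` with increments `≥ 19/25`). At `r = 2` this is
`PrestressSplitKorn.LayeredNear η` with the pinned box; at large `r` it is the output window of the line. -/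
def PinnedNear {N : ℕ} (r η : ℝ) (x : Fin N → E3) (i : Fin N) : Prop :=
  ∃ (A : E3 →ₗᵢ[ℝ] E3) (t : E3) (a : ℝ) (s : ℤ → ℤ) (z : ℤ → ℝ), InBoxPinned a z ∧ IsHaggSeq s ∧
    (∀ j : Fin N, dist (x j) (x i) ≤ r → ∃ l : ℤ × ℤ × ℤ, dist (x j + t) (A (layeredPos a s z l)) ≤ η) ∧
    (∀ l : ℤ × ℤ × ℤ, dist (A (layeredPos a s z l)) (x i + t) ≤ r →
      ∃ j : Fin N, dist (x j + t) (A (layeredPos a s z l)) ≤ η)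

/-- **The pinned box is inhabited by the ideal template** (`a = 1`, heights `m √(2/3)`): `19/25 ≤ √(2/3)` since
`(19/25)² = 361/625 ≤ 2/3`; with the tree's `inBox_idealHeights`. (Non-vacuity of every pinned statement below.) -/
theorem inBoxPinned_idealHeights : InBoxPinned 1 idealHeights := by
  refine ⟨inBox_idealHeights, fun m => ?_⟩
  have h1 : (19 / 25 : ℝ) ≤ Real.sqrt (2 / 3) := by
    rw [show (19 / 25 : ℝ) = Real.sqrt ((19 / 25) ^ 2) by rw [Real.sqrt_sq]; norm_num]
    exact Real.sqrt_le_sqrt (by norm_num)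
  have : idealHeights (m + 1) - idealHeights m = Real.sqrt (2 / 3) := by
    simp only [idealHeights]; push_cast; ring
  rw [this]
  exact h1

/-- The pinned box is a sub-box of the cone's box. -/
theorem inBox_of_inBoxPinned {a : ℝ} {z : ℤ → ℝ} (h : InBoxPinned a z) : InBox a z := h.1

/-- Increments of a pinned box are at least `19/25`. -/
theorem le_sub_of_inBoxPinned {a : ℝ} {z : ℤ → ℝ} (h : InBoxPinned a z) (m : ℤ) : 19 / 25 ≤ z (m + 1) - z m :=
  h.2 m

/-- A pinned `2`-window is a layered `2`-window (`PinnedNear 2 η ⇒ LayeredNear η`). -/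
theorem layeredNear_of_pinnedNear {N : ℕ} {η : ℝ} {x : Fin N → E3} {i : Fin N}
    (h : PinnedNear 2 η x i) : LayeredNear η x i := by
  obtain ⟨A, t, a, s, z, hbox, hs, h1, h2⟩ := h
  refine ⟨A, t, a, s, z, inBox_of_inBoxPinned hbox, hs, ?_, ?_⟩
  · intro j hj
    obtain ⟨l, hl⟩ := h1 j hj
    exact ⟨A (layeredPos a s z l), ⟨l, rfl⟩, hl⟩
  · rintro p ⟨l, rfl⟩ hp
    exact h2 l hp

/-- Pinned windows are monotone in the tolerance. -/
theorem pinnedNear_mono {N : ℕ} {r η η' : ℝ} {x : Fin N → E3} {i : Fin N} (hle : η ≤ η')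
    (h : PinnedNear r η x i) : PinnedNear r η' x i := by
  obtain ⟨A, t, a, s, z, hbox, hs, h1, h2⟩ := h
  refine ⟨A, t, a, s, z, hbox, hs, fun j hj => ?_, fun l hl => ?_⟩
  · obtain ⟨l, hl⟩ := h1 j hj
    exact ⟨l, hl.trans hle⟩
  · obtain ⟨j, hj⟩ := h2 l hl
    exact ⟨j, hj.trans hle⟩

/-! ## The statements of the line -/

/-- Generic shape of a coercivity inequality WITH SLACK for a site predicate `P` ("charged sites"):
the shape of `PrestressSplitKorn.SplitCoercivity` (stmt-13603, line prestress-split-korn, block S4) with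
`¬ LayeredNear η` replaced by `P`. Charge `c > 0` independent of the slack `θ`; depth `ρ` and boundary
constant `C` chosen after `θ`; `Ω` ranges over finite sets of sites whose `ρ`-neighbourhoods are crux-good. -/
def SlackCoercive (P : (N : ℕ) → (Fin N → E3) → Fin N → Prop) [∀ (N : ℕ) (x : Fin N → E3), DecidablePred (P N x)]
    (δ : ℝ) : Prop :=
  ∃ c : ℝ, 0 < c ∧ ∀ θ : ℝ, 0 < θ → ∃ ρ C : ℝ, 0 < ρ ∧
    ∀ (N : ℕ) (x : Fin N → E3), (∀ i j : Fin N, i ≠ j → δ ≤ dist (x i) (x j)) →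
    ∀ Ω : Finset (Fin N), (∀ i ∈ Ω, ∀ j : Fin N, dist (x j) (x i) ≤ ρ → Good x j) →
      c * ((Ω.filter fun i => P N x i).card : ℝ)
          - C * ((Ω.filter fun i => ∃ j : Fin N, j ∉ Ω ∧ dist (x j) (x i) ≤ ρ).card : ℝ)
          - θ * (Ω.card : ℝ)
        ≤ ∑ i ∈ Ω, ((1 / 2 : ℝ) * siteEnergy lennardJones x i -
            ⨅ Q : PeriodicConfiguration 3, Q.energyPerParticle lennardJones)

/-- **S2b — THE PINNING CHARGE (new; the 6711-specific load of the line: "scale is pinned by energy").**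
For every separation `δ` and tolerance `η ≤ 1/20` (only small `η` is ever consumed: the gluing tolerance, capped),
sites whose `2`-ball IS `η`-layered in the cone's box (increments
`≥ 39a/50`) but is NOT `η`-layered in the pinned box (increments `≥ 19/25`) — i.e. sites sitting in a locally
FLATTENED bilayer, interlayer spacing below `0.76` against the word-uniform optimum `h_w ≈ 0.793` — are charged
at a rate `c(δ, η) > 0` by the summed site-energy excess of any `ρ`-deep good block, up to a boundary term and a
slack `θ·#Ω` (`SlackCoercive` shape). Mechanism: uniform equilibrium of the crystal in `h` kills the first
order gap by gap (all bonds crossing ONE gap sum to zero force), the second order is the interlayer modulus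
`½·C₃₃,gap·(Δh)² > 0` (nn level `≈ 6.9 ε²` per site, `ε ≥ 4.2 %` here, i.e. `≳ 1e-2` per flattened site),
uniform in the Hägg word because every bond shorter than `2h_w` is intra-bilayer (ShortRangeStackingBlindness
used as a resource); chart non-uniqueness at cubic sites is harmless (ideal local `c/a` ⇒ all four `{111}`
spacings are `a√(2/3) ≥ 0.767 ≥ 19/25`). -/
def PinningCharge : Prop :=
  ∀ δ : ℝ, 0 < δ → ∀ η : ℝ, 0 < η → η ≤ 1 / 20 →
    SlackCoercive (fun N x i => LayeredNear η x i ∧ ¬ PinnedNear (N := N) 2 η x i) δ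

/-- **S3 — PINNED GLUING (potential-free discrete geometry; centred, pinned port of
`PrestressSplitKorn.LayeredGluing`, which is PROVED in the tree, `stub_layeredGluing`).** For every separation
`δ` and every scale `(R, ε)` there are a tolerance `η > 0` and a radius `R'` such that: if every particle within
`R'` of particle `i` of a `δ`-separated finite configuration is crux-good and carries a PINNED layered
`2`-window of tolerance `η`, then particle `i` carries a pinned layered window of radius `R` and tolerance `ε`
(one rigid image of ONE pinned box template, two-way `ε`-matched on the closed `R`-ball of `x i`). Proof route:
exact pinned rigidity (`exactLayeredRigidity_holds` + uniqueness of the stacking normal away from locally ideal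
cubic regions, where all four normals are pinned anyway) + compactness in the local matching topology exactly as
in `layeredGluing_of_exactRigidity` (the recentred limit set contains `0`, which centres the window at `x i`). -/
def PinnedGluing : Prop :=
  ∀ δ : ℝ, 0 < δ → ∀ R ε : ℝ, 0 < ε → ∃ η : ℝ, 0 < η ∧ ∃ R' : ℝ,
    ∀ (N : ℕ) (x : Fin N → E3), (∀ i j : Fin N, i ≠ j → δ ≤ dist (x i) (x j)) →
    ∀ i : Fin N, (∀ j : Fin N, dist (x j) (x i) ≤ R' → Good x j ∧ PinnedNear 2 η x j) →
      PinnedNear R ε x i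

/-! ## The registered stubs

The four `stub_*` theorems below are the REGISTERED obligations of the line; each is stated over tree vocabulary
only (`ReggeStarCoercivity.ZeroDefectDensity`, `PrestressSplitKorn.SplitCoercivity / LayeredNear / InBox /
layeredPos`, `PredicateAPI.Good`, Literature `IsHaggSeq / siteEnergy / lennardJones / PeriodicConfiguration`),
so a prover can land `theorem stub_… : <this signature>` in a Theorems file without importing this workfile.
The named Props `PinningCharge` / `PinnedGluing` above are the same statements folded through this file's
abbreviations (`pinningCharge_of_stub`, `pinnedGluing_of_stub` are `by simpa`/defeq). -/

/-- **S1 (INPUT, by name = item stmt-AtomisticToContinuum-13604 `ReggeStarCoercivity.ZeroDefectDensity`).**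
Along every sequence of Lennard-Jones ground states the fraction of particles whose first shell (radius `6/5`,
rescaled by `a ∈ [9/10, 11/10]`) is not `1/20`-close to the fcc or hcp kissing pattern tends to `0`. The
fixed-tolerance, fixed-radius, stacking-scale-free input of the card (its (i)–(iii)); follows from
`StarCoercivity` (13600) by `CoercivityForcesZeroDefects` (13605, proved) or from `CoerciveTwoShellGap` (13956)
by `HullBridgeExact.stub_badFraction` + `cc_good_of_isTwoShellGood`. Open-problem grade (shared, not new). -/
theorem stub_zeroDefectDensity :
    Summit.AtomisticToContinuum.Crystallization.Theses.ReggeStarCoercivity.ZeroDefectDensity := by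
  sorry

/-- **S2a (WORD-UNIFORM LAYERED COERCIVITY, by name = `PrestressSplitKorn.SplitCoercivity`, the registered
stub S4 of crux stmt-13603, line prestress-split-korn; survived that crux's drefute).** For every `δ, η` a
charge `c > 0` on non-`η`-layered sites of `ρ`-deep good blocks, up to boundary and slack. This is the card's
block inequality `Σ_Λ (½𝓔 − e*) ≥ λ Σ Δ_b² − C#∂Λ − τ#Λ` after Chebyshev + discrete Korn (the card's
`BarlowBlockCoercivity`, letter-free and word-uniform: `Ω` and the word are arbitrary). Intended proof (sibling
line): prestress split (landed) + tilted wells (landed) + funnel rigidity `K ≤ 16` (Bloch floor 8.25, survived)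
+ local template; law-level alternative: the 13603 core `stub_funnelDefectFloor` + Mecke pricing. XL. -/
theorem stub_splitCoercivity :
    Summit.AtomisticToContinuum.Crystallization.Theorems.PrestressSplitKorn.SplitCoercivity := by
  sorry

/-- **S2b (THE PINNING CHARGE — new, the 6711-specific load; see `PinningCharge` for the mechanism).**
For `δ > 0` and `0 < η ≤ 1/20`: a charge `c > 0` (independent of the slack `θ`), and after `θ` a depth `ρ` and a
boundary constant `C`, such that for every `δ`-separated finite configuration and every finite set `Ω` of sites
with `ρ`-deep crux-good neighbourhoods, `c·#{i ∈ Ω : the 2-ball of i is η-layered in the cone's box but NOT in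
the pinned box} − C·#{i ∈ Ω : within ρ of a particle outside Ω} − θ·#Ω ≤ Σ_{i∈Ω} (½𝓔ⁱ − e*)`. Numbers
(calc/pinning.py, planner folder): flattening one gap to `0.76` costs `6.6e-3` per site of the two adjacent layers
at `a = 0.9713` (`1.3e-2` at `a = 0.94`, `2.6e-3` at `a = 1`), identical for fcc / hcp / dhcp to `1e-4`;
`h_eq(a) ∈ [0.782, 0.804]` on the whole box, so every charged site is flattened by `≥ 0.022`. L–XL. -/
theorem stub_pinningCharge :
    ∀ δ : ℝ, 0 < δ → ∀ η : ℝ, 0 < η → η ≤ 1 / 20 →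
      ∃ c : ℝ, 0 < c ∧ ∀ θ : ℝ, 0 < θ → ∃ ρ C : ℝ, 0 < ρ ∧
        ∀ (N : ℕ) (x : Fin N → EuclideanSpace ℝ (Fin 3)), (∀ i j : Fin N, i ≠ j → δ ≤ dist (x i) (x j)) →
        ∀ Ω : Finset (Fin N), (∀ i ∈ Ω, ∀ j : Fin N, dist (x j) (x i) ≤ ρ → Good x j) →
          c * ((Ω.filter fun i => LayeredNear η x i ∧
                ¬ ∃ (A : EuclideanSpace ℝ (Fin 3) →ₗᵢ[ℝ] EuclideanSpace ℝ (Fin 3)) (t : EuclideanSpace ℝ (Fin 3))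
                    (a : ℝ) (s : ℤ → ℤ) (z : ℤ → ℝ),
                  (InBox a z ∧ ∀ m : ℤ, 19 / 25 ≤ z (m + 1) - z m) ∧ IsHaggSeq s ∧
                  (∀ j : Fin N, dist (x j) (x i) ≤ 2 →
                    ∃ l : ℤ × ℤ × ℤ, dist (x j + t) (A (layeredPos a s z l)) ≤ η) ∧
                  (∀ l : ℤ × ℤ × ℤ, dist (A (layeredPos a s z l)) (x i + t) ≤ 2 →
                    ∃ j : Fin N, dist (x j + t) (A (layeredPos a s z l)) ≤ η)).card : ℝ)
            - C * ((Ω.filter fun i => ∃ j : Fin N, j ∉ Ω ∧ dist (x j) (x i) ≤ ρ).card : ℝ)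
            - θ * (Ω.card : ℝ)
          ≤ ∑ i ∈ Ω, ((1 / 2 : ℝ) * siteEnergy lennardJones x i -
              ⨅ Q : PeriodicConfiguration 3, Q.energyPerParticle lennardJones) := by
  sorry

/-- **S3 (PINNED GLUING — new, potential-free; see `PinnedGluing` for the proof route).** For every separation
`δ` and scale `(R, ε)` there are `η > 0` and `R'` such that: if every particle within `R'` of particle `i` of a
`δ`-separated finite configuration is crux-good and its `2`-ball is two-way `η`-matched (after a translation) with a
rigid image of a PINNED box template, then the closed `R`-ball of `x i` is two-way `ε`-matched (after a
translation) with ONE rigid image of ONE pinned box template. L. -/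
theorem stub_pinnedGluing :
    ∀ δ : ℝ, 0 < δ → ∀ R ε : ℝ, 0 < ε → ∃ η : ℝ, 0 < η ∧ ∃ R' : ℝ,
      ∀ (N : ℕ) (x : Fin N → EuclideanSpace ℝ (Fin 3)), (∀ i j : Fin N, i ≠ j → δ ≤ dist (x i) (x j)) →
      ∀ i : Fin N,
        (∀ j : Fin N, dist (x j) (x i) ≤ R' → Good x j ∧
          ∃ (A : EuclideanSpace ℝ (Fin 3) →ₗᵢ[ℝ] EuclideanSpace ℝ (Fin 3)) (t : EuclideanSpace ℝ (Fin 3))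
              (a : ℝ) (s : ℤ → ℤ) (z : ℤ → ℝ),
            (InBox a z ∧ ∀ m : ℤ, 19 / 25 ≤ z (m + 1) - z m) ∧ IsHaggSeq s ∧
            (∀ k : Fin N, dist (x k) (x j) ≤ 2 →
              ∃ l : ℤ × ℤ × ℤ, dist (x k + t) (A (layeredPos a s z l)) ≤ η) ∧
            (∀ l : ℤ × ℤ × ℤ, dist (A (layeredPos a s z l)) (x j + t) ≤ 2 →
              ∃ k : Fin N, dist (x k + t) (A (layeredPos a s z l)) ≤ η)) →
        ∃ (A : EuclideanSpace ℝ (Fin 3) →ₗᵢ[ℝ] EuclideanSpace ℝ (Fin 3)) (t : EuclideanSpace ℝ (Fin 3))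
            (a : ℝ) (s : ℤ → ℤ) (z : ℤ → ℝ),
          (InBox a z ∧ ∀ m : ℤ, 19 / 25 ≤ z (m + 1) - z m) ∧ IsHaggSeq s ∧
          (∀ j : Fin N, dist (x j) (x i) ≤ R →
            ∃ l : ℤ × ℤ × ℤ, dist (x j + t) (A (layeredPos a s z l)) ≤ ε) ∧
          (∀ l : ℤ × ℤ × ℤ, dist (A (layeredPos a s z l)) (x i + t) ≤ R →
            ∃ j : Fin N, dist (x j + t) (A (layeredPos a s z l)) ≤ ε) :=
  -- LANDED: p159322 (`Theorems/ChessboardParticlePlanesLjLaminarWindowsPinnedGluing.lean`, parts p158862), worker of lead a1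
  Summit.AtomisticToContinuum.Crystallization.Theorems.StackingBlindBudgetFlatness.stub_pinnedGluing

/-- S2b folded through this file's abbreviations. -/
theorem pinningCharge_of_stub : PinningCharge := by
  intro δ hδ η hη hη'
  simpa only [SlackCoercive, PinnedNear, InBoxPinned, Finset.filter_congr_decidable] using
    stub_pinningCharge δ hδ η hη hη'

/-- S3 folded through this file's abbreviations. -/
theorem pinnedGluing_of_stub : PinnedGluing :=
  stub_pinnedGluing

/-! ## Rev 3 — the law-level form (PRIMARY) and the PalmRigidity alternative

Vocabulary of the hcp programme: `PalmGoodLaw.SetGood`, `IsRootedHardCore`, `IsPointStationaryLaw`, `hcpStacking`,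
`hcpPeriodicConfiguration` (all tree / Literature). -/

/-- **FLR — FUNNEL LAW RIGIDITY (registered stub; VERBATIM the second hypothesis of the landed R3
`PalmGoodLaw.ChargeFromFunnelLaw.stub_chargeFromFunnelLaw` of crux 13603).** A minimising (`E_P[h] ≤ e*`) point-stationary
`δ`-hard-core probability law almost surely carried by configurations all of whose points are `SetGood` is almost surely the counting
measure of a rotated EXACT relaxed hcp crystal `A '' hcpStacking a h` with `(a, h) ∈ [1/2, 2]²` and `e(hcp a h) = e*`.  Size: XL but
SHARED — it is `funnelLawRigidity_of_stubs stub_funnelDefectFloor stub_exactStarRigidity stub_exactSelectionLaw` in crux 13603's skeleton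
`Cruxes/DefectFreeCrystallizes/Lines/exact_star_shortcut.lean` (sorry-free glue; X2a/X2b/X2c/X3 LANDED as
`…ExactFrameH/…ExactFrameC/…FramePropagation/…ExactSelectionLaw`), i.e. it closes exactly when 13603's CORE `stub_funnelDefectFloor`
(law-level robust funnel floor `hcpE a₀ h₀ + κ·E_P[Dm] ≤ E_P[h]`) closes.  Why it might fail: only if the CORE fails (a minimising good law
with positive mean star defect — polytetrahedral / strained bulk at the hcp energy level).
Rev 4: `CORE → (this statement)` is LANDED as `PalmGoodLaw.ExactStarShortcut.funnelLawRigidity_of_core` (p162359); the intended closing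
line is `exact funnelLawRigidity_of_core stub_funnelDefectFloor`, writable once `…ExactStarShortcut` is importable next to the route file
(MuGSC / MuGroundStateConfiguration restructure, see the rev-4 status above). -/
theorem stub_funnelLawRigidity :
    ∀ δ : ℝ, 0 < δ → ∀ P : MeasureTheory.Measure (MeasureTheory.Measure (EuclideanSpace ℝ (Fin 3))),
      MeasureTheory.IsProbabilityMeasure P →
      (∀ᵐ μ ∂P, Literature.Probability.Process.IsRootedHardCore δ μ) → Literature.Probability.Process.IsPointStationaryLaw P →
      (∫ μ, (∫ y, lennardJones ‖y‖ ∂μ) / 2 ∂P) ≤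
        (⨅ Q : PeriodicConfiguration 3, Q.energyPerParticle lennardJones) →
      (∀ᵐ μ ∂P, ∃ S : Set (EuclideanSpace ℝ (Fin 3)),
        μ = (MeasureTheory.Measure.count : MeasureTheory.Measure (EuclideanSpace ℝ (Fin 3))).restrict S ∧
          ∀ y ∈ S, Summit.AtomisticToContinuum.Crystallization.Theorems.PalmGoodLaw.SetGood S y) →
      ∀ᵐ μ ∂P, ∃ a h : ℝ, ∃ ha : a ≠ 0, ∃ hh : h ≠ 0, 1 / 2 ≤ a ∧ a ≤ 2 ∧ 1 / 2 ≤ h ∧ h ≤ 2 ∧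
        ∃ A : EuclideanSpace ℝ (Fin 3) ≃ₗᵢ[ℝ] EuclideanSpace ℝ (Fin 3),
          (hcpPeriodicConfiguration ha hh).energyPerParticle lennardJones =
            (⨅ Q : PeriodicConfiguration 3, Q.energyPerParticle lennardJones) ∧
          μ = (MeasureTheory.Measure.count : MeasureTheory.Measure (EuclideanSpace ℝ (Fin 3))).restrict (A '' hcpStacking a h) := by
  sorry

/-- **THE SKELETON THEOREM (PRIMARY, rev 3) — `LjLaminarWindows` from `stub_zeroDefectDensity` (S1 = item 13604) and
`stub_funnelLawRigidity` (FLR ⇐ 13603's CORE)**, by the tree theorem `StackingBlindBudgetFlatness.LjLaminarWindows_of_funnelLawRigidity`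
(p161919: `stub_goodLaw` + minimality of the limit law + pinning-is-free + unique `hcpE` minimiser + enclosure `h₀ ≥ 0.7928` + density
transfer + `matched_hcp_of_matched_near` + laminar reading + p137588). -/
theorem LjLaminarWindows_of :
    Summit.AtomisticToContinuum.Crystallization.Theses.ChessboardParticlePlanes.LjLaminarWindows :=
  Summit.AtomisticToContinuum.Crystallization.Theorems.StackingBlindBudgetFlatness.LjLaminarWindows_of_funnelLawRigidity
    stub_zeroDefectDensity stub_funnelLawRigidity

/-- **PR — PALM RIGIDITY (registered stub = route PalmUnimodularRigidity's target `PalmRigidity` BY NAME).** Every minimising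
point-stationary hard-core law (Mecke form) is a.s. a rotated exact relaxed hcp crystal with optimal parameters.  ⇐ cruxes 9225
`MinimiserShells` ∧ 9226 `LayeredLawsSelectHcp` (glue `cruxesToPalmRigidity_proof` + `ShellsToBarlowChart_of`, landed).  XL, SHARED. -/
theorem stub_palmRigidity :
    Summit.AtomisticToContinuum.Crystallization.Theses.PalmUnimodularRigidity.PalmRigidity := by
  sorry

/-- **ALTERNATIVE A — `LjLaminarWindows` from `stub_palmRigidity` alone** (tree theorem `LjLaminarWindows_of_palmRigidity`, p161919:
for ALL ground-state sequences through the PROVED Benjamini–Schramm limit `benjaminiSchrammLimit_proof`, no zero-defect input). -/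
theorem LjLaminarWindows_of_palm :
    Summit.AtomisticToContinuum.Crystallization.Theses.ChessboardParticlePlanes.LjLaminarWindows :=
  Summit.AtomisticToContinuum.Crystallization.Theorems.StackingBlindBudgetFlatness.LjLaminarWindows_of_palmRigidity stub_palmRigidity

/-! ## ALT B — the block-level chain is ONE landed door (rev 5)

The glue of rev 1–4 (cover lemma, generic squeeze, clean pinned centres, pinned windows at every scale, laminar reading; formerly
`slackCoercive_of_cover … oneWindowAllScales_of_stubs` in this file) is the tree door `Theorems.StackingBlindBudgetFlatness.stub_blockWindows`
/ `LjLaminarWindows_of_blockCoercivity` (`Theorems/ChessboardParticlePlanesLjLaminarWindowsBlockDoor.lean`, lead c16) over the landed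
`…PinnedSqueeze` (p157869) and `…PinnedGluing` (p159322); only the registered statements remain here. -/

/-- The step S9♭ ⇒ crux as a named Prop (so that the only theorem of this file whose conclusion is the crux decl BY NAME is
the composition `LjLaminarWindows_of`; the skeleton audit takes the first such theorem). -/
def CruxOfOneWindowAllScales : Prop :=
  (∀ x : (N : ℕ) → (Fin N → EuclideanSpace ℝ (Fin 3)),
      (∀ N, IsGroundState lennardJones (x N)) →
      ∀ η : ℝ, 0 < η → ∀ L : ℝ, ∃ᶠ N in Filter.atTop,
        ∃ (i : Fin N) (A : EuclideanSpace ℝ (Fin 3) →ₗᵢ[ℝ] EuclideanSpace ℝ (Fin 3)) (T : Set ℝ),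
          (∀ t ∈ T, ∀ t' ∈ T, t ≠ t' → (3 : ℝ) / 4 ≤ |t - t'|) ∧
          (∀ j : Fin N, dist (x N j) (x N i) ≤ L → ∃ t ∈ T, |(A (x N j - x N i)) 2 - t| ≤ η)) →
    Summit.AtomisticToContinuum.Crystallization.Theses.ChessboardParticlePlanes.LjLaminarWindows

/-- **S9♭ ⇒ crux — the tree theorem `LjLaminarWindowsSketch.LjLaminarWindows_of_oneWindowAllScales` (p137588), carried
as a registered stub ONLY while its module cannot be imported next to `Theses.ChessboardParticlePlanes` rev 4** (duplicate
Literature modules `MuGSC` / `MuGroundStateConfiguration`, see the header comment; `CruxOfOneWindowAllScales` is p137588's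
statement verbatim). Closes by
`exact Summit.AtomisticToContinuum.Crystallization.Theorems.LjLaminarWindowsSketch.LjLaminarWindows_of_oneWindowAllScales`
(with the third import restored). The energy clause and the `7/10`-separation of the crux are produced there by averaging /
window removal / shell bounds (landed c0–c13 tower), not assumed anywhere in this line. Size: 1 line; not work. -/
theorem stub_cruxOfOneWindowAllScales : CruxOfOneWindowAllScales :=
  -- CLOSED (rev 2): the tree theorem p137588, importable again after p159647 repaired the import incident
  Summit.AtomisticToContinuum.Crystallization.Theorems.LjLaminarWindowsSketch.LjLaminarWindows_of_oneWindowAllScales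

/-- **DOOR B (registered stub `stub_blockWindows`, rev 5; LANDING as `Theorems/ChessboardParticlePlanesLjLaminarWindowsBlockDoor.lean`):
the whole block-level chain of the line as ONE door at the one-window level — `ZeroDefectDensity → SplitCoercivity → (pinning charge,
raw form of `stub_pinningCharge`) → S9♭` — over the landed glue (pinned gluing p159322, generic squeeze / clean centres / laminar reading
p157869) plus the cover lemma; cone-neutral inputs, so insensitive to the MuGSC / MuGroundStateConfiguration import split.  Size: done
(Theorems file, lean check rc 0); LANDED p165360 (commit e82fcbb5): this stub is CLOSED by the tree theorem of the same name. -/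
theorem stub_blockWindows :
    Summit.AtomisticToContinuum.Crystallization.Theses.ReggeStarCoercivity.ZeroDefectDensity →
    Summit.AtomisticToContinuum.Crystallization.Theorems.PrestressSplitKorn.SplitCoercivity →
    (∀ δ : ℝ, 0 < δ → ∀ η : ℝ, 0 < η → η ≤ 1 / 20 →
      ∃ c : ℝ, 0 < c ∧ ∀ θ : ℝ, 0 < θ → ∃ ρ C : ℝ, 0 < ρ ∧
        ∀ (N : ℕ) (x : Fin N → EuclideanSpace ℝ (Fin 3)), (∀ i j : Fin N, i ≠ j → δ ≤ dist (x i) (x j)) →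
        ∀ Ω : Finset (Fin N), (∀ i ∈ Ω, ∀ j : Fin N, dist (x j) (x i) ≤ ρ → Good x j) →
          c * ((Ω.filter fun i => LayeredNear η x i ∧
                ¬ ∃ (A : EuclideanSpace ℝ (Fin 3) →ₗᵢ[ℝ] EuclideanSpace ℝ (Fin 3)) (t : EuclideanSpace ℝ (Fin 3))
                    (a : ℝ) (s : ℤ → ℤ) (z : ℤ → ℝ),
                  (InBox a z ∧ ∀ m : ℤ, 19 / 25 ≤ z (m + 1) - z m) ∧ IsHaggSeq s ∧
                  (∀ j : Fin N, dist (x j) (x i) ≤ 2 →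
                    ∃ l : ℤ × ℤ × ℤ, dist (x j + t) (A (layeredPos a s z l)) ≤ η) ∧
                  (∀ l : ℤ × ℤ × ℤ, dist (A (layeredPos a s z l)) (x i + t) ≤ 2 →
                    ∃ j : Fin N, dist (x j + t) (A (layeredPos a s z l)) ≤ η)).card : ℝ)
            - C * ((Ω.filter fun i => ∃ j : Fin N, j ∉ Ω ∧ dist (x j) (x i) ≤ ρ).card : ℝ)
            - θ * (Ω.card : ℝ)
          ≤ ∑ i ∈ Ω, ((1 / 2 : ℝ) * siteEnergy lennardJones x i -
              ⨅ Q : PeriodicConfiguration 3, Q.energyPerParticle lennardJones)) →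
    ∀ x : (N : ℕ) → (Fin N → EuclideanSpace ℝ (Fin 3)),
      (∀ N, IsGroundState lennardJones (x N)) →
      ∀ η : ℝ, 0 < η → ∀ L : ℝ, ∃ᶠ N in Filter.atTop,
        ∃ (i : Fin N) (A : EuclideanSpace ℝ (Fin 3) →ₗᵢ[ℝ] EuclideanSpace ℝ (Fin 3)) (T : Set ℝ),
          (∀ t ∈ T, ∀ t' ∈ T, t ≠ t' → (3 : ℝ) / 4 ≤ |t - t'|) ∧
          (∀ j : Fin N, dist (x N j) (x N i) ≤ L → ∃ t ∈ T, |(A (x N j - x N i)) 2 - t| ≤ η) :=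
  -- LANDED: p165360 (`Theorems/ChessboardParticlePlanesLjLaminarWindowsBlockDoor.lean`, lead c16)
  Summit.AtomisticToContinuum.Crystallization.Theorems.StackingBlindBudgetFlatness.stub_blockWindows

/-- **ALTERNATIVE B through DOOR B**: the crux from `stub_zeroDefectDensity`, `stub_splitCoercivity`, `stub_pinningCharge` by the
registered door `stub_blockWindows` and the closed step S9♭ ⇒ crux (`stub_cruxOfOneWindowAllScales` = p137588). -/
theorem LjLaminarWindows_of_blockDoor :
    Summit.AtomisticToContinuum.Crystallization.Theses.ChessboardParticlePlanes.LjLaminarWindows :=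
  (show CruxOfOneWindowAllScales from stub_cruxOfOneWindowAllScales)
    (stub_blockWindows stub_zeroDefectDensity stub_splitCoercivity stub_pinningCharge)

end Summit.AtomisticToContinuum.Crystallization.Cruxes.LjLaminarWindows.StackingBlindBudgetFlatness

end
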